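import Summits.PneNP.PneNP.Theses.OneSlice
import Summits.PneNP.PneNP.Theorems.ConstantBand.Negative.LoadBearing
import Literature.Computability.Complexity.RossmanMonotoneCliqueGraphs

/-!
# Route OneSlice, crux `ConstantBand` (stmt-PneNP-2834): vocabulary of the line `flat-prior-relative-minterms`

Objects posited by the line `flat-prior-relative-minterms` for the crux
`Summit.PneNP.PneNP.Theses.OneSlice.ConstantBand` (skeleton
`Summits/PneNP/PneNP/Cruxes/ConstantBand/Lines/flat-prior-relative-minterms.lean`, whose registered stubs are
stated in exactly this vocabulary and namespace; every stub file imports this module).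

Everything is a finite counting fraction on Hamming slices of the edge cube of `K_n` (no measure theory):

* re-exported from `Theorems/ConstantBand/Negative/LoadBearing.lean` (the standing disprover's schedule form of
  the crux, already in the tree — not re-declared): `Edge n` (edge variables of `K_n`), `thr k n`
  (`m_k(n) = ⌊C(n,2)·n^{-2/(k-1)}⌋₊`), `Central k n j` (`|j - m_k(n)| ≤ m_k(n)^{3/4}`), `slice n i`
  (the Erdős–Rényi slice `G(n,i)` as a finset), `errSet`, `bandErr`, `BandLB c k w δ` (the crux at fixed
  parameters) and the `Iff.rfl` bridge `constantBand_iff`;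
* `band j w = [j-w, j+w]`, `lowerBand k j w = [j-w, j+w-C(k,2)]` (the slices from which a whole planted
  `k`-clique still lands in the band);
* `sliceProb n i P` = `P_{x ∼ G(n,i)}[P x]`; `pairProb n k i P` = `P_{(x,A)}[P x A]` with `A` an independent
  uniform `k`-set (the PLANTED-PAIR measure); `tripleProb n k i P` = the same with a uniform edge `e` of `K_A`;
* `plantSub A e x = x ∪ (K_A − e)` (a maximal proper sub-planting); `IsRelMinterm f x A` — `K_A ∖ x` is a
  genuine minterm of the relativised monotone function `f(x ∪ ·)` (Rossman FOCS'10 §6, relativised);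
* the schedule form `ConstantBandSchedule` (RHS of `constantBand_iff`), the transfer target `BandPair` (the
  card's C⁺, Theorem-1 shape at ONE law) and the five named obligations of the line: `SliceLemma23` (S1),
  `NearCliqueContiguity` (S2), `RelMintermPlanted`/`RelMintermStep` (S3), `RelMintermSparse` (S4, the engine,
  open), `TransferStep` (S5); and (appended, cycle 2) `AdvSparse`, the engine in distinguishing form.

Definitions only: no fact is asserted here (the obligations are `Prop`s; their proofs land as
`OneSliceConstantBand<Stub>.lean --supports stmt-PneNP-2834`, the composition `ConstantBand_of` lives in the
skeleton). Sources of the shapes: Rossman, *The monotone complexity of k-clique on random graphs* (FOCS 2010 /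
SICOMP 2014) Thm 1, Lemmas 15, 23; idea card `Cruxes/ConstantBand/Ideas/flat-prior-relative-minterms.md`;
`Cruxes/ConstantBand/Disproof.lean` §0 (schedule form), §5 (band pseudo-complements).
-/

noncomputable section

namespace Summit.PneNP.PneNP.Cruxes.ConstantBand.FlatPriorRelativeMinterms

open Literature.Computability.Complexity Finset Filter Classical

-- `Summit.PneNP.PneNP.…`: the summit and its single sub-problem share the name (D-0017), so the linter's
-- duplicate-namespace warning is structural here, exactly as in `Theorems/ConstantBand/Negative/LoadBearing.lean`.
set_option linter.dupNamespace false

export Summit.PneNP.PneNP.Theorems.ConstantBand.Negative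
  (Edge thr Central central_thr slice errSet bandErr BandLB constantBand_iff bandErr_nonneg)

/-! ## Bands and counting fractions -/

/-- The band of slice indices `[j − w, j + w]` (ℕ-truncated exactly as in the crux: `bandErr n k j w C` is the
sum over `band j w` by `rfl`). -/
def band (j w : ℕ) : Finset ℕ := Icc (j - w) (j + w)

/-- The LOWER band `[j − w, j + w − C(k,2)]`: the slices from which a whole planted `k`-clique still lands in the
band. -/
def lowerBand (k j w : ℕ) : Finset ℕ := Icc (j - w) (j + w - k.choose 2)

/-- `P_{x ∼ G(n,i)}[P x]`: the uniform (counting) probability of an event on the slice `i`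
(junk value `0` on an empty slice, `i > C(n,2)`). -/
def sliceProb (n i : ℕ) (P : (Edge n → Bool) → Prop) : ℝ :=
  (#((slice n i).filter P) : ℝ) / (#(slice n i) : ℝ)

/-- The PLANTED-PAIR measure: `x` uniform on the slice `i`, `A` an independent uniform `k`-subset of the
vertices; `P_{(x,A)}[P x A]` as a counting fraction (junk `0` if the slice is empty or `k > n`). -/
def pairProb (n k i : ℕ) (P : (Edge n → Bool) → Finset (Fin n) → Prop) : ℝ :=
  (#(((slice n i) ×ˢ powersetCard k (univ : Finset (Fin n))).filter fun xa => P xa.1 xa.2) : ℝ) /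
    ((#(slice n i) : ℝ) * (n.choose k : ℝ))

/-- The triple measure: `(x, A)` as in `pairProb` and `e` a uniform edge of `K_A` (`e ∈ edgesIn A`, `C(k,2)` of
them); used to average over the `C(k,2)` maximal proper sub-plantings `x ∪ (K_A − e)`. -/
def tripleProb (n k i : ℕ) (P : (Edge n → Bool) → Finset (Fin n) → Edge n → Prop) : ℝ :=
  (#((((slice n i) ×ˢ powersetCard k (univ : Finset (Fin n))) ×ˢ (univ : Finset (Edge n))).filter
      fun t => t.2 ∈ edgesIn t.1.2 ∧ P t.1.1 t.1.2 t.2) : ℝ) /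
    ((#(slice n i) : ℝ) * (n.choose k : ℝ) * (k.choose 2 : ℝ))

/-- Planting `K_A` minus the edge `e`: `x ∪ (K_A − e)` (a maximal proper sub-planting when `e ∈ K_A ∖ x`).
-/
def plantSub {n : ℕ} (A : Finset (Fin n)) (e : Edge n) (x : Edge n → Bool) : Edge n → Bool :=
  fun e' => x e' || (cliqueVec A e' && decide (e' ≠ e))

/-- `K_A` is a RELATIVE MINTERM of `f` at the background `x`: `f(x) = 0`, `f(x ∪ K_A) = 1`, and every `y` with
`x ≤ y < x ∪ K_A` has `f(y) = 0` — i.e. `K_A ∖ x` is a genuine minterm of the relativised function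
`f^x := f(x ∪ ·)` (Rossman FOCS'10 §6, "`k`-cliques as minterms of `C̄`", relativised at `x`). -/
def IsRelMinterm {n : ℕ} (f : (Edge n → Bool) → Bool) (x : Edge n → Bool) (A : Finset (Fin n)) : Prop :=
  f x = false ∧ f (plantClique A x) = true ∧
    ∀ y : Edge n → Bool, x ≤ y → y ≤ plantClique A x → y ≠ plantClique A x → f y = false

/-! ## The crux in schedule form and the transfer target -/

/-- The crux in schedule form, `∀ c, ∃ k ≥ 3, ∃ w, ∃ δ > 0, BandLB c k w δ` — the right-hand side of the
disprover's bridge `constantBand_iff : ConstantBand ↔ ConstantBandSchedule` (`Iff.rfl`). -/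
def ConstantBandSchedule : Prop :=
  ∀ c : ℕ, ∃ k : ℕ, 3 ≤ k ∧ ∃ w : ℕ, ∃ δ : ℝ, 0 < δ ∧ BandLB c k w δ

/-- **BandPair** (the line's transfer target C⁺, Theorem-1 shape at ONE law). For every exponent `c` there are
`k ≥ 3`, a width `w` and `γ > 0` such that, eventually in `n`, for every central `j` and every
`{∧₂,∨₂}`-circuit `C` of size `≤ n^c`: if `C` rejects at most a `γ`-fraction of the planted pairs `x ∪ K_A`
(`x` uniform on a lower-band slice, slices weighted equally, `A` a uniform `k`-set), then `C` accepts MORE THAN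
HALF of the band (slices weighted equally). Strictly stronger than the crux; typed in the
"(accept planted ≥ 1−γ) ⇒ (accept band > 1/2)" form because the indistinguishability form is false on the band
(`T_{≥ j−w+C(k,2)}` has advantage `C(k,2)/(2w+1)`). -/
def BandPair : Prop :=
  ∀ c : ℕ, ∃ k : ℕ, 3 ≤ k ∧ ∃ w : ℕ, ∃ γ : ℝ, 0 < γ ∧ ∀ᶠ n : ℕ in atTop, ∀ j : ℕ, Central k n j →
    ∀ C : Circuit (Edge n), C.IsOver monotoneBasis → C.size ≤ n ^ c →
      ∑ i ∈ lowerBand k j w, pairProb n k i (fun x A => C.eval (plantClique A x) = false)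
          ≤ γ * #(lowerBand k j w) →
      ∑ i ∈ band j w, sliceProb n i (fun x => C.eval x = false) < (1 / 2 : ℝ) * #(band j w)

/-! ## The five obligations of the line (statements only) -/

/-- **S1 · slice Lemma 23** (planted vs uniform on ONE slice, Cauchy–Schwarz form, crude constant). For `k ≥ 3`
there is a constant `L = L(k)` such that for any width `w` and `ε > 0`, eventually in `n`: for central `j`, every
band slice `i` and EVERY `f`,
`P_{x ∼ G(n,i), A}[f(x ∪ K_A) = 0] ≤ √(L · P_{y ∼ G(n,i+C(k,2))}[f(y) = 0 ∧ CLIQUE_k(y)]) + ε`.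
(Off the overlap event `K_A ∩ x ≠ ∅` the law of `x ∪ K_A` has density `ω_k(y)/E[ω_k]` w.r.t. the uniform law
on the slice `i + C(k,2)`, and `E_i[ω_k²]/E_i[ω_k]²` is bounded on central bands — the sharp value `→ 1 + k!`
is not needed by the transfer; the `G(n,p)` twin is Rossman FOCS'10 Lemma 23.) -/
def SliceLemma23 : Prop :=
  ∀ k : ℕ, 3 ≤ k → ∃ L : ℝ, 0 < L ∧ ∀ w : ℕ, ∀ ε : ℝ, 0 < ε → ∀ᶠ n : ℕ in atTop, ∀ j : ℕ, Central k n j →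
    ∀ i ∈ band j w, ∀ f : (Edge n → Bool) → Bool,
      pairProb n k i (fun x A => f (plantClique A x) = false) ≤
        Real.sqrt (L * sliceProb n (i + k.choose 2) (fun y => f y = false ∧ cliqueFn n k y = true)) + ε

/-- **S2 · near-clique contiguity** on the slice. For `k ≥ 3`, any `w`, `ε > 0`, eventually in `n`: for central
`j`, every band slice `i` and every event `S`, `P_{(x,A,e)}[x ∪ (K_A − e) ∈ S] ≤ P_{y ∼ G(n, i + C(k,2) − 1)}[y ∈ S] + ε`
— planting `K_k` minus one edge into a critical slice is invisible (one-sided total variation `→ 0`; the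
likelihood ratio is `X(y)/E[X]·(1+o(1))`, `X(y) = #{(A,e) : K_A − e ⊆ y, e ∉ y}`, with `Var X/(E X)² → 0`
because every sub-pattern of `K_k^-` is supercritical at `p = n^{-2/(k-1)}`). -/
def NearCliqueContiguity : Prop :=
  ∀ k : ℕ, 3 ≤ k → ∀ w : ℕ, ∀ ε : ℝ, 0 < ε → ∀ᶠ n : ℕ in atTop, ∀ j : ℕ, Central k n j →
    ∀ i ∈ band j w, ∀ S : Finset (Edge n → Bool),
      tripleProb n k i (fun x A e => plantSub A e x ∈ S) ≤
        sliceProb n (i + k.choose 2 - 1) (fun y => y ∈ S) + ε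

/-- **RelMintermPlanted** — the relative-minterm lemma in planted-acceptance normalisation (Rossman's Lemma 15
at ONE law, relativised). For `k ≥ 3` and `γ > 0` there is `w₀` such that for every `w ≥ w₀`, eventually in
`n`: for central `j` and every MONOTONE `f`, if `f` rejects at most a `γ`-fraction of the planted pairs from
the lower band and rejects at least half of the band, then `K_A` is a relative minterm of `f` at `x` for at
least a `(1/2 − 2γ)`-fraction of the lower-band pairs `(x, A)`. -/
def RelMintermPlanted : Prop :=
  ∀ k : ℕ, 3 ≤ k → ∀ γ : ℝ, 0 < γ → ∃ w₀ : ℕ, ∀ w : ℕ, w₀ ≤ w → ∀ᶠ n : ℕ in atTop, ∀ j : ℕ,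
    Central k n j → ∀ f : (Edge n → Bool) → Bool, Monotone f →
      ∑ i ∈ lowerBand k j w, pairProb n k i (fun x A => f (plantClique A x) = false)
          ≤ γ * #(lowerBand k j w) →
      (1 / 2 : ℝ) * #(band j w) ≤ ∑ i ∈ band j w, sliceProb n i (fun x => f x = false) →
      (1 / 2 - 2 * γ) * #(lowerBand k j w) ≤
        ∑ i ∈ lowerBand k j w, pairProb n k i (IsRelMinterm f)

/-- **S3 · the relative-minterm step**: near-clique contiguity (+ flat prior + monotonicity + a union bound over
the `C(k,2)` maximal sub-plantings) gives `RelMintermPlanted`. -/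
def RelMintermStep : Prop :=
  NearCliqueContiguity → RelMintermPlanted

/-- **S4 · the ENGINE** (open): relative clique-minterms of small monotone circuits are sparse under the band
law. For every `c` there are `k ≥ 3`, a constant `ρ < 1/2` and `w₁` such that for every `w ≥ w₁`, eventually
in `n`: for central `j` and every `{∧₂,∨₂}`-circuit of size `≤ n^c`, `K_A` is a relative minterm of `C.eval`
at `x` for at most a `ρ`-fraction of the lower-band pairs `(x, A)`. (One-law relativised form of Rossman
FOCS'10 §5–7; strictly stronger than the crux; NOT implied by anything in the tree.) -/
def RelMintermSparse : Prop :=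
  ∀ c : ℕ, ∃ k : ℕ, 3 ≤ k ∧ ∃ ρ : ℝ, ρ < 1 / 2 ∧ ∃ w₁ : ℕ, ∀ w : ℕ, w₁ ≤ w → ∀ᶠ n : ℕ in atTop,
    ∀ j : ℕ, Central k n j → ∀ C : Circuit (Edge n), C.IsOver monotoneBasis → C.size ≤ n ^ c →
      ∑ i ∈ lowerBand k j w, pairProb n k i (IsRelMinterm C.eval) ≤ ρ * #(lowerBand k j w)

/-- **S5 · the transfer `BandPair → ConstantBand`** (in schedule form), modulo slice Lemma 23: with
`δ := min (γ²/(4L)) (1/6)` (`L` from S1), a `δ`-accurate small monotone `C` on a central band has planted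
rejection `≤ γ·#lower` (S1) and band rejection `≥ #band/2` (first moment `P_i[CLIQUE_k] ≤ 2/k!`),
contradicting `BandPair`. -/
def TransferStep : Prop :=
  SliceLemma23 → BandPair → ConstantBandSchedule

/-! ## Definitional bridge (the registered sub-goal this vocabulary file proves) -/

/-- The crux summand read over `band`: `bandErr n k j w C = Σ_{i ∈ band j w} #errSet_i / #slice_i` (by `rfl`;
`band j w` is `Icc (j - w) (j + w)`), so stub files may rewrite the disprover's `bandErr` as a sum over the line's
`band`. -/
theorem fprm_bandErr_eq_sum_band :
    ∀ (n k j w : ℕ) (C : Circuit (Edge n)),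
      bandErr n k j w C = ∑ i ∈ band j w, (#(errSet n k i C) : ℝ) / (#(slice n i) : ℝ) :=
  fun _ _ _ _ _ => rfl

/-! ## The engine in distinguishing form (lead, cycle 2) -/

/-- **AdvSparse** — the engine S4 in DISTINGUISHING (advantage) form: for every `c` there are `k ≥ 3`, a
constant `ρ < 1/2` and `w₁` such that for every `w ≥ w₁`, eventually in `n`, for central `j` and every
`{∧₂,∨₂}`-circuit `C` of size `≤ n^c`, the planted-`k`-clique DETECTION ADVANTAGE of `C` summed over the lower
band, `Σ_{i ∈ lower} (P_{(x,A), x ∼ G(n,i)}[C(x ∪ K_A) = 1] − P_{x ∼ G(n,i)}[C(x) = 1])`, is at most `ρ·#lower`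
("no fixed-polynomial monotone circuit is an FPT average-case planted-clique distinguisher at the appearance
threshold"). It implies `RelMintermSparse` slice by slice (relative-minterm density ≤ advantage for monotone `C`)
and implies `BandPair` directly (no contiguity, no flat prior): see `OneSliceConstantBandAdvSparseGlue.lean`.
Open; strictly stronger than the crux; recorded as the cleanest statement of the line's residual difficulty. -/
def AdvSparse : Prop :=
  ∀ c : ℕ, ∃ k : ℕ, 3 ≤ k ∧ ∃ ρ : ℝ, ρ < 1 / 2 ∧ ∃ w₁ : ℕ, ∀ w : ℕ, w₁ ≤ w → ∀ᶠ n : ℕ in atTop,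
    ∀ j : ℕ, Central k n j → ∀ C : Circuit (Edge n), C.IsOver monotoneBasis → C.size ≤ n ^ c →
      ∑ i ∈ lowerBand k j w, (pairProb n k i (fun x A => C.eval (plantClique A x) = true)
          - sliceProb n i (fun x => C.eval x = true)) ≤ ρ * #(lowerBand k j w)

end Summit.PneNP.PneNP.Cruxes.ConstantBand.FlatPriorRelativeMinterms

end
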